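import Summits.QuantumFields.YangMills.Theorems.LuscherReductionTwistedTraceScalingGaugeAverage
import Summits.QuantumFields.YangMills.Theorems.LuscherReductionTwistedTraceScalingElectricSplit
import HarnessLib

/-!
# The transfer operator in STEP FORM: `(K_β φ)(U) = ∫ E_β(1, W) e^{−(β/2)(S(U) + S(W·U))} φ(W·U) dW`
# (lane B of S-BASE, crux `TwistedTraceScaling` stmt-QuantumFields-20203; covariant reformulation of the Laplace step, blueprint §5, brick c4 part i)

Right invariance of the a-priori (Haar) measure turns the `V`-integral into an integral over the kinetic step `W = V·U⁻¹`, and the electric factor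
sees only the step: `E_β(U, W·U) = E_β(1, W)` (each link: `U_e (W_e U_e)⁻¹ = W_e⁻¹`).  So around ANY configuration `U` the Laplace step is the
vacuum-chart integral of `…VacuumPattern` / `…ChartTransport` in the variable `W` (near `1`, `|w| ~ β^{−1/2}` linkwise), with the magnetic weight
`e^{−(β/2)S(W·U)}` controlled through `…CurvatureAction` (S exact in `F`) and brick c1 (`F(W·U) = F(U) + D_U w + O(τ² + τ|F|)`).
HONEST FRAMING: bookkeeping; femto rung R2b1 (stub of a child of a CONDITIONAL route); not a gap, not Clay.
-/

set_option autoImplicit false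

noncomputable section

open MeasureTheory
open Literature.MathematicalPhysics.QuantumFieldTheory
open Literature.MathematicalPhysics.QuantumLattice

namespace Summit.QuantumFields.YangMills.Theorems.FemtoTransferGap.TwoLattice.Cov

open Summit.QuantumFields.YangMills.Theorems.FemtoTransferGap

variable {L : ℕ} [NeZero L]

/-- ★ The electric factor sees only the step: `E_β(U, W·U) = E_β(1, W)`. [cite: SeilerLNP1982, §3] -/
theorem latE_mul_left_eq (β : ℝ) (U W : GaugeConfig 3 L SU2) : latE L β U (W * U) = latE L β 1 W := by
  unfold latE
  refine Finset.prod_congr rfl fun e _ => ?_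
  simp only [Pi.mul_apply, Pi.one_apply, mul_inv_rev, one_mul]
  rw [← mul_assoc, mul_inv_cancel, one_mul]

/-- The kernel in step form: `K_β(U, W·U) = E_β(1, W) · e^{−(β/2)(S(U) + S(W·U))}`. [cite: SeilerLNP1982, §3] -/
theorem transferKernel_mul_left_eq (β : ℝ) (U W : GaugeConfig 3 L SU2) :
    transferKernel su2Rep β U (W * U) = latE L β 1 W * Real.exp (-(β / 2) * (wilsonAction su2Rep U + wilsonAction su2Rep (W * U))) := by
  rw [transferKernel_eq_latE_mul, latE_mul_left_eq]

/-- ★ **STEP FORM OF THE TRANSFER OPERATOR** (right invariance of Haar): `(K_β φ)(U) = ∫ K_β(U, W·U) φ(W·U) dW`. [cite: SeilerLNP1982, §3] -/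
theorem transferApply_eq_integral_step (β : ℝ) (φ : GaugeConfig 3 L SU2 → ℝ) (U : GaugeConfig 3 L SU2) :
    transferApply β φ U = ∫ W, transferKernel su2Rep β U (W * U) * φ (W * U) ∂configMeasure SU2 L := by
  unfold transferApply configMeasure
  exact (integral_mul_right_eq_self (fun V => transferKernel su2Rep β U V * φ V) U).symm

/-- ★ The same with the kernel factorised: `(K_β φ)(U) = ∫ E_β(1,W) e^{−(β/2)(S(U)+S(W·U))} φ(W·U) dW`. [cite: SeilerLNP1982, §3] -/
theorem transferApply_eq_integral_step' (β : ℝ) (φ : GaugeConfig 3 L SU2 → ℝ) (U : GaugeConfig 3 L SU2) :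
    transferApply β φ U =
      ∫ W, latE L β 1 W * Real.exp (-(β / 2) * (wilsonAction su2Rep U + wilsonAction su2Rep (W * U))) * φ (W * U)
        ∂configMeasure SU2 L := by
  rw [transferApply_eq_integral_step]
  refine integral_congr_ae (ae_of_all _ fun W => ?_)
  show transferKernel su2Rep β U (W * U) * φ (W * U) = _
  rw [transferKernel_mul_left_eq]

omit [NeZero L] in
/-- Gauge transformations act on steps by conjugation at the base points: `g·(W·U) = (g W g⁻¹)·(g·U)` where `(gWg⁻¹)_e = g_{x_e} W_e g_{x_e}⁻¹`.
[cite: SeilerLNP1982, §2] -/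
theorem gaugeTransform_mul (g : Site 3 L → SU2) (W U : GaugeConfig 3 L SU2) :
    gaugeTransform g (W * U) = (fun e => g e.1 * W e * (g e.1)⁻¹) * gaugeTransform g U := by
  funext e
  simp only [gaugeTransform, Pi.mul_apply]
  group

end Summit.QuantumFields.YangMills.Theorems.FemtoTransferGap.TwoLattice.Cov

end
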